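import Literature.Analysis.ValidatedNumerics.ExpPoly.Correlation
import Literature.Analysis.ValidatedNumerics.TaylorModelQuadrature
import Literature.Analysis.ValidatedNumerics.ListPolynomial
import Mathlib.Algebra.Polynomial.Roots
import HarnessLib

/-!
# Exact exp-polynomial algebra over `ℚ`, V: certifying a correlation polynomial by interpolation

Continues `ExpPoly/Correlation.lean`.  `Poly.corr u v b` computes the correlation polynomial
`C(t) = ∫_{-b}^{b-t} u(x+t) v(x) dx` exactly, but through BIVARIATE lists, which for inputs of degree ≈ 55 with
30-digit coefficients costs minutes of kernel time — more than one `decide` may spend.  This file certifies a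
CANDIDATE increment polynomial `E` (supplied as data) against `p` WITHOUT evaluating `Poly.corr` in the kernel:

* `Poly.taylorShiftH p c` (`eval (taylorShiftH p c) y = p(c + y)`, univariate Horner) and
  `Poly.corrAt p b t = ∫_{-b}^{b-t} p(x+t) p(x) dx` as an exact rational through the univariate antiderivative
  (`corrAt_eq : corrAt p b t = eval (corr p p b) t`, by `eval_corr` and the fundamental theorem of calculus) —
  `O(deg²)` small operations per point;
* `Poly.incCheckAt p E b t : Bool` — the point identity `t·E(t) = 2 C(0) − 2 C(t)`;
* `Poly.inc_identity_of_checks` — if the point identity holds at the `L` distinct rationals `ts j` and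
  `L` exceeds the lengths of `0 :: E` and of `corr p p b`, then `t·E(t) = d(0) − d(t)` for ALL real `t`,
  `d = 2 · corr p p b` (two polynomials of degree `< L` agreeing at `L` points; Mathlib
  `Polynomial.eq_of_natDegree_lt_card_of_eval_eq` via `PolyMP.toPoly`).

So a windowed trial vector's increment `D_t = t·E(t)` is certified by `L ≈ 115` small kernel checks.

## References

* Lagrange interpolation / a nonzero polynomial of degree `< L` has fewer than `L` roots. [folklore]
-/

open Real MeasureTheory intervalIntegral Polynomial

namespace Literature.Analysis.ValidatedNumerics

/-! ### Degree of a coefficient list -/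

namespace PolyMP

/-- `natDegree (toPoly as) ≤ |as|` (indeed `< |as|` for non-empty lists; this weak form suffices). [folklore] -/
theorem natDegree_toPoly_le_length (as : List ℝ) : (toPoly as).natDegree ≤ as.length := by
  rw [Polynomial.natDegree_le_iff_coeff_eq_zero]
  intro N hN
  rw [coeff_toPoly, List.getD_eq_default _ _ (by omega)]

end PolyMP

namespace ExpPoly

namespace Poly

/-! ### Univariate Taylor shift and the correlation at a rational point -/

/-- Univariate Taylor shift by Horner: the coefficient list of `y ↦ p(c + y)` in `O(deg²)` coefficient operations
(`ExpPoly/SecondDifference.lean`'s `Poly.taylorShift` has the same values but goes through the bivariate `BPoly.taylor`,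
`O(deg³)`, too slow in the kernel at degree `≈ 110`). [folklore] -/
def taylorShiftH (p : Poly) (c : ℚ) : Poly := p.foldr (fun a acc => add [a] (mul [c, 1] acc)) []

/-- `eval (taylorShiftH p c) y = eval p (c + y)`. [folklore] -/
theorem eval_taylorShiftH (c : ℚ) (y : ℝ) : ∀ p : Poly, eval (taylorShiftH p c) y = eval p ((c : ℝ) + y)
  | [] => by simp [taylorShiftH]
  | a :: p => by
      have ih := eval_taylorShiftH c y p
      simp only [taylorShiftH, List.foldr_cons] at ih ⊢
      rw [eval_add, eval_mul, ih]
      simp [eval]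

/-- `C_p(t) = ∫_{-b}^{b-t} p(x+t) p(x) dx` as an exact rational, through the univariate antiderivative of
`p(t + ·) · p`. [folklore] -/
def corrAt (p : Poly) (b t : ℚ) : ℚ :=
  evalQ (ad 0 (mul (taylorShiftH p t) p)) (b - t) - evalQ (ad 0 (mul (taylorShiftH p t) p)) (-b)

/-- `corrAt p b t = eval (corr p p b) t`. [folklore] -/
theorem corrAt_eq (p : Poly) (b t : ℚ) : ((corrAt p b t : ℚ) : ℝ) = eval (corr p p b) t := by
  rw [eval_corr]
  have hF : ∫ x in (-(b : ℝ))..((b : ℝ) - t), eval p (x + t) * eval p x =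
      ∫ x in (-(b : ℝ))..((b : ℝ) - t), eval (mul (taylorShiftH p t) p) x := by
    refine integral_congr fun x _ => ?_
    simp only [eval_mul, eval_taylorShiftH, add_comm (t : ℝ) x]
  rw [hF, integral_eq_sub_of_hasDerivAt (fun x _ => PolyMP.hasDerivAt_eval_ad_zero (mul (taylorShiftH p t) p) x)
    ((continuous_eval _).intervalIntegrable _ _), corrAt]
  rw [Rat.cast_sub, eval_evalQ, eval_evalQ]
  push_cast
  ring

/-! ### The point checks and the interpolation argument -/

/-- The point identity `t · E(t) = 2 C(0) − 2 C(t)` over `ℚ`. [folklore] -/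
def incCheckAt (p E : Poly) (b t : ℚ) : Bool :=
  decide (t * evalQ E t = 2 * corrAt p b 0 - 2 * corrAt p b t)

/-- **Certification of an increment polynomial by interpolation.**  If `incCheckAt p E b (ts j)` holds at `L`
pairwise distinct rationals and `L` exceeds the lengths of `0 :: E` (by one) and of `corr p p b`, then for every real `t`,
`t · E(t) = d(0) − d(t)` with `d = 2 · corr p p b` — i.e. `E = incTail d` as functions. [folklore] -/
theorem inc_identity_of_checks (p E : Poly) (b : ℚ) {L : ℕ} (hLE : E.length + 2 ≤ L)
    (hLc : (corr p p b).length + 1 ≤ L) (ts : Fin L → ℚ) (hts : Function.Injective ts)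
    (hchk : ∀ j : Fin L, incCheckAt p E b (ts j) = true) (t : ℝ) :
    t * eval E t = eval (smul 2 (corr p p b)) 0 - eval (smul 2 (corr p p b)) t := by
  -- the two polynomials `X · E` and `d(0) − d`
  set d : Poly := smul 2 (corr p p b) with hd
  set P1 : ℝ[X] := X * PolyMP.toPoly (E.map ((↑) : ℚ → ℝ)) with hP1
  set P2 : ℝ[X] := C (eval d 0) - PolyMP.toPoly (d.map ((↑) : ℚ → ℝ)) with hP2
  have hev1 : ∀ s : ℝ, P1.eval s = s * eval E s := by
    intro s; rw [hP1, Polynomial.eval_mul, Polynomial.eval_X, PolyMP.eval_toPoly, ← eval_eq_evalR]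
  have hev2 : ∀ s : ℝ, P2.eval s = eval d 0 - eval d s := by
    intro s; rw [hP2, Polynomial.eval_sub, Polynomial.eval_C, PolyMP.eval_toPoly, ← eval_eq_evalR]
  -- degrees
  have hdeg1 : P1.natDegree < L := by
    have h1 : (PolyMP.toPoly (E.map ((↑) : ℚ → ℝ))).natDegree ≤ E.length := by
      simpa using PolyMP.natDegree_toPoly_le_length (E.map ((↑) : ℚ → ℝ))
    have hX : (X : ℝ[X]).natDegree ≤ 1 := Polynomial.natDegree_X_le
    have hmul : P1.natDegree ≤ (X : ℝ[X]).natDegree + (PolyMP.toPoly (E.map ((↑) : ℚ → ℝ))).natDegree :=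
      Polynomial.natDegree_mul_le
    omega
  have hdeg2 : P2.natDegree < L := by
    have hlen : (d.map ((↑) : ℚ → ℝ)).length = (corr p p b).length := by simp [hd, smul]
    have h2 : (PolyMP.toPoly (d.map ((↑) : ℚ → ℝ))).natDegree ≤ (corr p p b).length := by
      simpa [hlen] using PolyMP.natDegree_toPoly_le_length (d.map ((↑) : ℚ → ℝ))
    calc P2.natDegree ≤ max (C (eval d 0) : ℝ[X]).natDegree (PolyMP.toPoly (d.map ((↑) : ℚ → ℝ))).natDegree :=
          Polynomial.natDegree_sub_le _ _
      _ ≤ (corr p p b).length := by rw [Polynomial.natDegree_C]; exact max_le (Nat.zero_le _) h2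
      _ < L := by omega
  -- agreement at the nodes
  have hinj : Function.Injective (fun j : Fin L ↦ ((ts j : ℚ) : ℝ)) := by
    intro i j hij
    have hij' : ((ts i : ℚ) : ℝ) = ((ts j : ℚ) : ℝ) := hij
    exact hts (by exact_mod_cast hij')
  have heval : ∀ j : Fin L, P1.eval ((ts j : ℚ) : ℝ) = P2.eval ((ts j : ℚ) : ℝ) := by
    intro j
    have hc := hchk j
    unfold incCheckAt at hc
    have hq : (ts j : ℚ) * evalQ E (ts j) = 2 * corrAt p b 0 - 2 * corrAt p b (ts j) := of_decide_eq_true hc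
    have hr : ((ts j : ℚ) : ℝ) * eval E (ts j) = 2 * ((corrAt p b 0 : ℚ) : ℝ) - 2 * ((corrAt p b (ts j) : ℚ) : ℝ) := by
      rw [← eval_evalQ]; exact_mod_cast hq
    rw [hev1, hev2, hr, corrAt_eq, corrAt_eq, hd, eval_smul, eval_smul]
    push_cast
    ring
  have hcard : max P1.natDegree P2.natDegree < Fintype.card (Fin L) := by
    rw [Fintype.card_fin]; exact max_lt hdeg1 hdeg2
  have hPQ := Polynomial.eq_of_natDegree_lt_card_of_eval_eq P1 P2 hinj heval hcard
  have := congrArg (fun P : ℝ[X] ↦ P.eval t) hPQ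
  simp only [hev1, hev2] at this
  exact this

/-- **ℕ-indexed form** of `inc_identity_of_checks` (nodes `ts j`, `j < L`, pairwise distinct), the shape used by generated
certificate files (`interval_cases`). [folklore] -/
theorem inc_identity_of_checks_nat (p E : Poly) (b : ℚ) {L : ℕ} (hLE : E.length + 2 ≤ L)
    (hLc : (corr p p b).length + 1 ≤ L) (ts : ℕ → ℚ) (hts : ∀ i j, i < L → j < L → ts i = ts j → i = j)
    (hchk : ∀ j, j < L → incCheckAt p E b (ts j) = true) (t : ℝ) :
    t * eval E t = eval (smul 2 (corr p p b)) 0 - eval (smul 2 (corr p p b)) t :=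
  inc_identity_of_checks p E b hLE hLc (fun j : Fin L => ts j)
    (fun i j h => Fin.ext (hts i j i.isLt j.isLt h)) (fun j => hchk j j.isLt) t

/-- The standard nodes `j / 64` are pairwise distinct. [folklore] -/
theorem nodes_div_injective (c : ℚ) (hc : c ≠ 0) (i j : ℕ) (h : (i : ℚ) / c = (j : ℚ) / c) : i = j := by
  have : (i : ℚ) = j := by
    field_simp at h
    exact h
  exact_mod_cast this

end Poly

end ExpPoly

end Literature.Analysis.ValidatedNumerics
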